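import Summits.NavierStokesRegularity.NavierStokesRegularity.Theorems.CalmSliceGateOneSymmetricSliceQuantised
import HarnessLib

/-!
# Crux `FiniteDissipationLiouville` (stmt-NavierStokesRegularity-22144): point group of a
# finite-dissipation Type-I singularity — TOOLS (one generator controls the whole rotation group)

Theorems file of route `LerayQuarterDissipation` (lead prover ns-lqd-lead g10; `--supports` the crux;
tools for `…PointGroup.lean`). Navier–Stokes regularity is NOT proved by anything here; no summit is.

Deterministic geometry of an (almost) symmetry of ONE field under ONE conjugated rotation
`ρ_{g,α} x = g (R_α (g⁻¹ x))` (`g` a linear isometry of `ℝ³`, `R_α = rotZ α`) on a ball `B(0, ρ)`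
about the apex (the conjugated-rotation bookkeeping `conj_rotZ_add`, `norm_conj_rotZ`, `conj_rotZ_sub`,
`norm_conj_rotZ_sub_self_le` is the sister file `OneSymmetricSlice.Quantised`'s, seat ns-lqd-p2 g7):

* `iterate_defect_le` — the defect TELESCOPES: `‖v(ρ_{g,α}x) − ρ_{g,α}v(x)‖ ≤ η` on the ball gives
  `‖v(ρ_{g,kα}x) − ρ_{g,kα}v(x)‖ ≤ kη` for all `k : ℕ` (ball invariant, `ρ` an isometry);
  `iterate_symmetry` (`η = 0`), `symmetry_neg` (the inverse of an exact symmetry is one).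
* `angle_decomp` — `θ = θ' + kα + 2πm`, `0 ≤ θ' < α`, `k : ℕ`, `kα ≤ 2π`, `m : ℤ`.
* `defect_allAngles_le` — **one small angle controls all angles**: for a differentiable field with
  `‖∇v‖ ≤ L` and `‖v‖ ≤ B` on `B(0, ρ)`, a `ρ_{g,α}`-defect `≤ η` on `B(0, ρ)` (ONE real angle `α > 0`)
  gives a `ρ_{g,θ}`-defect `≤ (2π/α) η + α (L ρ + B)` for EVERY `θ` (peel off `k ≤ 2π/α` exact steps,
  pay the remainder angle `θ' < α` with the mean value inequality and `‖R_{θ'} z − z‖ ≤ θ'‖z‖`).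

References: elementary; G. Seregin, V. Šverák, Comm. PDE 34 (2009) and `OneSymmetricSlice` (24452)
are where these tools are consumed (`…PointGroup.lean`).
-/

noncomputable section

-- the summit and its single sub-problem share the name (CONVENTIONS §1), as in every Theorems file
set_option linter.dupNamespace false

namespace Summit.NavierStokesRegularity.NavierStokesRegularity.Theorems.FiniteDissipationLiouville.PointGroup

open MeasureTheory Set Filter Topology Metric Function
open Literature.Analysis Literature.Analysis.FluidPDE
open Summit.NavierStokesRegularity.NavierStokesRegularity.Theorems.OneSymmetricSlice.Quantised
open scoped ENNReal NNReal

/-! ### Rotation bookkeeping -/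

/-- `R_{θ − 2πm} = R_θ` for every integer `m`. -/
theorem rotZ_sub_int_mul_two_pi (θ : ℝ) (m : ℤ) (x : EuclideanSpace ℝ (Fin 3)) :
    rotZ (θ - m * (2 * Real.pi)) x = rotZ θ x := by
  ext i
  fin_cases i <;> simp [Real.cos_sub_int_mul_two_pi, Real.sin_sub_int_mul_two_pi]

variable (g : EuclideanSpace ℝ (Fin 3) ≃ₗᵢ[ℝ] EuclideanSpace ℝ (Fin 3))

/-- `ρ_{g,θ}` maps the ball `B(0, ρ)` into itself. -/
theorem conj_mem_ball {ρ : ℝ} (θ : ℝ) {x : EuclideanSpace ℝ (Fin 3)} (hx : x ∈ ball (0 : EuclideanSpace ℝ (Fin 3)) ρ) :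
    g (rotZ θ (g.symm x)) ∈ ball (0 : EuclideanSpace ℝ (Fin 3)) ρ := by
  rw [mem_ball_zero_iff] at hx ⊢
  rwa [norm_conj_rotZ]

/-- `ρ_{g,θ}` is an isometry: `‖ρ_{g,θ} a − ρ_{g,θ} b‖ = ‖a − b‖`. -/
theorem norm_conj_sub_conj (θ : ℝ) (a b : EuclideanSpace ℝ (Fin 3)) :
    ‖g (rotZ θ (g.symm a)) - g (rotZ θ (g.symm b))‖ = ‖a - b‖ := by
  rw [← conj_rotZ_sub, norm_conj_rotZ]

/-! ### Iterating an (almost) symmetry of one slice on a ball about the apex -/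

/-- **The defect telescopes along the iterates.** If `‖v(ρ_{g,α} x) − ρ_{g,α} v(x)‖ ≤ η` on
`B(0, ρ)`, then `‖v(ρ_{g,kα} x) − ρ_{g,kα} v(x)‖ ≤ k η` on `B(0, ρ)` for every `k : ℕ` (the ball is
invariant and `ρ_{g,α}` is an isometry). -/
theorem iterate_defect_le {v : EuclideanSpace ℝ (Fin 3) → EuclideanSpace ℝ (Fin 3)} {α η ρ : ℝ}
    (h : ∀ x ∈ ball (0 : EuclideanSpace ℝ (Fin 3)) ρ,
      ‖v (g (rotZ α (g.symm x))) - g (rotZ α (g.symm (v x)))‖ ≤ η) :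
    ∀ k : ℕ, ∀ x ∈ ball (0 : EuclideanSpace ℝ (Fin 3)) ρ,
      ‖v (g (rotZ ((k : ℝ) * α) (g.symm x))) - g (rotZ ((k : ℝ) * α) (g.symm (v x)))‖ ≤ k * η := by
  intro k
  induction k with
  | zero =>
    intro x _
    simp [rotZ_zero]
  | succ k ih =>
    intro x hx
    set y : EuclideanSpace ℝ (Fin 3) := g (rotZ ((k : ℝ) * α) (g.symm x)) with hy
    have hyB : y ∈ ball (0 : EuclideanSpace ℝ (Fin 3)) ρ := conj_mem_ball g _ hx
    have e1 : ((k + 1 : ℕ) : ℝ) * α = α + (k : ℝ) * α := by push_cast; ring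
    have eL : v (g (rotZ (((k + 1 : ℕ) : ℝ) * α) (g.symm x))) = v (g (rotZ α (g.symm y))) := by
      rw [e1, conj_rotZ_add]
    have eR : g (rotZ (((k + 1 : ℕ) : ℝ) * α) (g.symm (v x))) =
        g (rotZ α (g.symm (g (rotZ ((k : ℝ) * α) (g.symm (v x)))))) := by
      rw [e1, conj_rotZ_add]
    rw [eL, eR]
    have hsplit : v (g (rotZ α (g.symm y))) - g (rotZ α (g.symm (g (rotZ ((k : ℝ) * α) (g.symm (v x)))))) =
        (v (g (rotZ α (g.symm y))) - g (rotZ α (g.symm (v y)))) +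
          (g (rotZ α (g.symm (v y))) - g (rotZ α (g.symm (g (rotZ ((k : ℝ) * α) (g.symm (v x))))))) := by
      abel
    rw [hsplit]
    refine (norm_add_le _ _).trans ?_
    rw [norm_conj_sub_conj]
    have h1 := h y hyB
    have h2 := ih x hx
    push_cast
    linarith

/-- **An exact symmetry iterates exactly**: `v(ρ_{g,α} x) = ρ_{g,α} v(x)` on `B(0, ρ)` gives
`v(ρ_{g,kα} x) = ρ_{g,kα} v(x)` on `B(0, ρ)` for every `k : ℕ`. -/
theorem iterate_symmetry {v : EuclideanSpace ℝ (Fin 3) → EuclideanSpace ℝ (Fin 3)} {α ρ : ℝ}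
    (h : ∀ x ∈ ball (0 : EuclideanSpace ℝ (Fin 3)) ρ,
      v (g (rotZ α (g.symm x))) = g (rotZ α (g.symm (v x)))) (k : ℕ) :
    ∀ x ∈ ball (0 : EuclideanSpace ℝ (Fin 3)) ρ,
      v (g (rotZ ((k : ℝ) * α) (g.symm x))) = g (rotZ ((k : ℝ) * α) (g.symm (v x))) := by
  intro x hx
  have h0 : ∀ x ∈ ball (0 : EuclideanSpace ℝ (Fin 3)) ρ,
      ‖v (g (rotZ α (g.symm x))) - g (rotZ α (g.symm (v x)))‖ ≤ 0 := fun x hx => by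
    rw [h x hx, sub_self, norm_zero]
  have := iterate_defect_le g h0 k x hx
  rw [mul_zero] at this
  exact sub_eq_zero.1 (norm_le_zero_iff.1 this)

/-- **The inverse of a symmetry is a symmetry**: `v(ρ_{g,β} x) = ρ_{g,β} v(x)` on `B(0, ρ)` gives the
same for `−β`. -/
theorem symmetry_neg {v : EuclideanSpace ℝ (Fin 3) → EuclideanSpace ℝ (Fin 3)} {β ρ : ℝ}
    (h : ∀ x ∈ ball (0 : EuclideanSpace ℝ (Fin 3)) ρ,
      v (g (rotZ β (g.symm x))) = g (rotZ β (g.symm (v x)))) :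
    ∀ x ∈ ball (0 : EuclideanSpace ℝ (Fin 3)) ρ,
      v (g (rotZ (-β) (g.symm x))) = g (rotZ (-β) (g.symm (v x))) := by
  intro x hx
  set y : EuclideanSpace ℝ (Fin 3) := g (rotZ (-β) (g.symm x)) with hy
  have hyB : y ∈ ball (0 : EuclideanSpace ℝ (Fin 3)) ρ := conj_mem_ball g _ hx
  have hxy : g (rotZ β (g.symm y)) = x := by
    rw [hy, LinearIsometryEquiv.symm_apply_apply, ← rotZ_add, add_neg_cancel, rotZ_zero,
      LinearIsometryEquiv.apply_symm_apply]
  have key := h y hyB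
  rw [hxy] at key
  -- `v x = ρ_{g,β} (v y)` ⇒ `ρ_{g,-β} (v x) = v y`
  rw [key, LinearIsometryEquiv.symm_apply_apply, ← rotZ_add, neg_add_cancel, rotZ_zero,
    LinearIsometryEquiv.apply_symm_apply]

/-! ### Reduction of an arbitrary angle modulo `2π` and modulo the steps `α` -/

/-- Every angle `θ` is `θ' + kα + 2πm` with `0 ≤ θ' < α`, `k : ℕ`, `kα ≤ 2π`, `m : ℤ` (for `α > 0`). -/
theorem angle_decomp {α : ℝ} (hα : 0 < α) (θ : ℝ) :
    ∃ (m : ℤ) (k : ℕ) (θ' : ℝ), 0 ≤ θ' ∧ θ' < α ∧ (k : ℝ) * α ≤ 2 * Real.pi ∧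
      θ = θ' + (k : ℝ) * α + m * (2 * Real.pi) := by
  have h2π : 0 < 2 * Real.pi := by positivity
  set m : ℤ := ⌊θ / (2 * Real.pi)⌋ with hm
  set θ₁ : ℝ := θ - m * (2 * Real.pi) with hθ₁
  have hθ₁0 : 0 ≤ θ₁ := by
    have h1 : (m : ℝ) ≤ θ / (2 * Real.pi) := Int.floor_le _
    rw [hθ₁, sub_nonneg]
    calc (m : ℝ) * (2 * Real.pi) ≤ θ / (2 * Real.pi) * (2 * Real.pi) :=
          mul_le_mul_of_nonneg_right h1 h2π.le
      _ = θ := div_mul_cancel₀ θ h2π.ne'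
  have hθ₁lt : θ₁ < 2 * Real.pi := by
    have h1 : θ / (2 * Real.pi) < (m : ℝ) + 1 := Int.lt_floor_add_one _
    rw [hθ₁]
    have : θ < ((m : ℝ) + 1) * (2 * Real.pi) := by
      calc θ = θ / (2 * Real.pi) * (2 * Real.pi) := (div_mul_cancel₀ θ h2π.ne').symm
        _ < ((m : ℝ) + 1) * (2 * Real.pi) := mul_lt_mul_of_pos_right h1 h2π
    linarith
  set k : ℕ := ⌊θ₁ / α⌋₊ with hk
  refine ⟨m, k, θ₁ - (k : ℝ) * α, ?_, ?_, ?_, ?_⟩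
  · have h1 : (k : ℝ) ≤ θ₁ / α := Nat.floor_le (div_nonneg hθ₁0 hα.le)
    rw [sub_nonneg]
    calc (k : ℝ) * α ≤ θ₁ / α * α := mul_le_mul_of_nonneg_right h1 hα.le
      _ = θ₁ := div_mul_cancel₀ θ₁ hα.ne'
  · have h1 : θ₁ / α < (k : ℝ) + 1 := Nat.lt_floor_add_one _
    have : θ₁ < ((k : ℝ) + 1) * α := by
      calc θ₁ = θ₁ / α * α := (div_mul_cancel₀ θ₁ hα.ne').symm
        _ < ((k : ℝ) + 1) * α := mul_lt_mul_of_pos_right h1 hα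
    linarith
  · have h1 : (k : ℝ) ≤ θ₁ / α := Nat.floor_le (div_nonneg hθ₁0 hα.le)
    calc (k : ℝ) * α ≤ θ₁ / α * α := mul_le_mul_of_nonneg_right h1 hα.le
      _ = θ₁ := div_mul_cancel₀ θ₁ hα.ne'
      _ ≤ 2 * Real.pi := hθ₁lt.le
  · rw [hθ₁]; ring

/-! ### The deterministic estimate: one small almost-symmetry angle ⇒ almost axisymmetry -/

/-- **One small angle controls all angles.** If a differentiable field `v` with `‖∇v‖ ≤ L`
everywhere and `‖v‖ ≤ B` on `B(0, ρ)` satisfies `‖v(ρ_{g,α} x) − ρ_{g,α} v(x)‖ ≤ η` on `B(0, ρ)` for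
ONE angle `α > 0`, then for EVERY angle `θ` and every `x ∈ B(0, ρ)`:
`‖v(ρ_{g,θ} x) − ρ_{g,θ} v(x)‖ ≤ (2π/α) η + α (L ρ + B)`. -/
theorem defect_allAngles_le {v : EuclideanSpace ℝ (Fin 3) → EuclideanSpace ℝ (Fin 3)} {L B ρ α η : ℝ}
    (hα : 0 < α) (hL0 : 0 ≤ L)
    (hdiff : ∀ x, DifferentiableAt ℝ v x) (hL : ∀ x, ‖fderiv ℝ v x‖ ≤ L)
    (hB : ∀ x ∈ ball (0 : EuclideanSpace ℝ (Fin 3)) ρ, ‖v x‖ ≤ B)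
    (h : ∀ x ∈ ball (0 : EuclideanSpace ℝ (Fin 3)) ρ,
      ‖v (g (rotZ α (g.symm x))) - g (rotZ α (g.symm (v x)))‖ ≤ η) :
    ∀ θ : ℝ, ∀ x ∈ ball (0 : EuclideanSpace ℝ (Fin 3)) ρ,
      ‖v (g (rotZ θ (g.symm x))) - g (rotZ θ (g.symm (v x)))‖ ≤
        2 * Real.pi / α * η + α * (L * ρ + B) := by
  intro θ x hx
  have hη0 : 0 ≤ η := by
    have := h x hx
    exact (norm_nonneg _).trans this
  obtain ⟨m, k, θ', hθ'0, hθ'α, hk2π, hθ⟩ := angle_decomp hα θ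
  -- reduce modulo `2π`
  have ered : ∀ z : EuclideanSpace ℝ (Fin 3), rotZ θ z = rotZ (θ' + (k : ℝ) * α) z := by
    intro z
    have := rotZ_sub_int_mul_two_pi (θ' + (k : ℝ) * α + m * (2 * Real.pi)) m z
    rw [add_sub_cancel_right] at this
    rw [hθ, this]
  set y : EuclideanSpace ℝ (Fin 3) := g (rotZ ((k : ℝ) * α) (g.symm x)) with hy
  have hyB : y ∈ ball (0 : EuclideanSpace ℝ (Fin 3)) ρ := conj_mem_ball g _ hx
  have hyn : ‖y‖ < ρ := mem_ball_zero_iff.1 hyB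
  have eL : v (g (rotZ θ (g.symm x))) = v (g (rotZ θ' (g.symm y))) := by
    rw [ered, conj_rotZ_add]
  have eR : g (rotZ θ (g.symm (v x))) =
      g (rotZ θ' (g.symm (g (rotZ ((k : ℝ) * α) (g.symm (v x)))))) := by
    rw [ered, conj_rotZ_add]
  rw [eL, eR]
  -- three pieces
  have hsplit : v (g (rotZ θ' (g.symm y))) - g (rotZ θ' (g.symm (g (rotZ ((k : ℝ) * α) (g.symm (v x)))))) =
      (v (g (rotZ θ' (g.symm y))) - v y) + (v y - g (rotZ θ' (g.symm (v y)))) +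
        (g (rotZ θ' (g.symm (v y))) - g (rotZ θ' (g.symm (g (rotZ ((k : ℝ) * α) (g.symm (v x))))))) := by
    abel
  rw [hsplit]
  refine (norm_add₃_le).trans ?_
  -- piece 1: Lipschitz
  have h1 : ‖v (g (rotZ θ' (g.symm y))) - v y‖ ≤ α * (L * ρ) := by
    have hmv := (convex_univ (𝕜 := ℝ) (E := EuclideanSpace ℝ (Fin 3))).norm_image_sub_le_of_norm_fderiv_le
      (f := v) (fun z _ => hdiff z) (fun z _ => hL z) (mem_univ y) (mem_univ (g (rotZ θ' (g.symm y))))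
    refine hmv.trans ?_
    have hd : ‖g (rotZ θ' (g.symm y)) - y‖ ≤ |θ'| * ‖y‖ := norm_conj_rotZ_sub_self_le g θ' y
    rw [abs_of_nonneg hθ'0] at hd
    calc L * ‖g (rotZ θ' (g.symm y)) - y‖ ≤ L * (|θ'| * ‖y‖) := by
          rw [abs_of_nonneg hθ'0]; exact mul_le_mul_of_nonneg_left hd hL0
      _ ≤ L * (α * ρ) := by
          rw [abs_of_nonneg hθ'0]
          exact mul_le_mul_of_nonneg_left (mul_le_mul hθ'α.le hyn.le (norm_nonneg _) hα.le) hL0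
      _ = α * (L * ρ) := by ring
  -- piece 2: small rotation of a bounded vector
  have h2 : ‖v y - g (rotZ θ' (g.symm (v y)))‖ ≤ α * B := by
    rw [norm_sub_rev]
    refine (norm_conj_rotZ_sub_self_le g θ' (v y)).trans ?_
    rw [abs_of_nonneg hθ'0]
    have hBy := hB y hyB
    have hB0 : 0 ≤ B := (norm_nonneg _).trans hBy
    exact mul_le_mul hθ'α.le hBy (norm_nonneg _) hα.le
  -- piece 3: the telescoped defect of the exact steps
  have h3 : ‖g (rotZ θ' (g.symm (v y))) - g (rotZ θ' (g.symm (g (rotZ ((k : ℝ) * α) (g.symm (v x))))))‖ ≤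
      2 * Real.pi / α * η := by
    rw [norm_conj_sub_conj]
    refine (iterate_defect_le g h k x hx).trans ?_
    have hk : (k : ℝ) ≤ 2 * Real.pi / α := by rwa [le_div_iff₀ hα]
    exact mul_le_mul_of_nonneg_right hk hη0
  calc ‖v (g (rotZ θ' (g.symm y))) - v y‖ + ‖v y - g (rotZ θ' (g.symm (v y)))‖ +
        ‖g (rotZ θ' (g.symm (v y))) - g (rotZ θ' (g.symm (g (rotZ ((k : ℝ) * α) (g.symm (v x))))))‖
      ≤ α * (L * ρ) + α * B + 2 * Real.pi / α * η := by linarith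
    _ = 2 * Real.pi / α * η + α * (L * ρ + B) := by ring

end Summit.NavierStokesRegularity.NavierStokesRegularity.Theorems.FiniteDissipationLiouville.PointGroup
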